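import Summits.CriticalPhenomena.LaceExpansionHighD.WeightSplitChain
import HarnessLib

/-!
# The diagram-level weight split "LEMMA J", layer B3: the J-free inequality for ARBITRARY non-negative even weights
# (monotone limit of the finite-support theorem, in `ℝ≥0∞`) — cell pub-lace7, Lean seat 3

PROGRAMME-INTERNAL (no printed counterpart; NOT CITABLE as literature).  Continues `WeightSplitDrift` (layer A: block drifts),
`WeightSplitChain` (B1: the `N = 1` cross-term sign; B2: `chain3_weightSplit_le`, the three-block chain for FINITELY SUPPORTED block
weights).  Context: [FvdH17]-ext (BoundNOne) `‖x‖₂² ≤ 3(‖w‖₂² + ‖z−w‖₂² + ‖x−z‖₂²)`; `b2b-lace` LEMMA-J Thm 3 (i).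

This layer removes the finite-support hypothesis: for ARBITRARY non-negative even block weights `gL, g, gR : ℤ^d → ℝ` (in the
application: products of two-point functions, summable but of infinite support), bond weights `κ ≥ 0` on a finite set `E` of vectors of
Euclidean length `≤ 1`, and every rung configuration `(r₀, s)`,
`Σ_e κ_e Σ'_{w,b,c} ‖w+b+c‖² · gL(w+r₀)gL(w) · g(b+s−e)g(b) · gR(c−r₀−s)gR(c) ≤ Σ_e κ_e Σ'_{w,b,c} (‖w‖²+‖b‖²+‖c‖²) · (same weight)`
as an inequality between `[0, ∞]`-valued nested sums (`chain3_weightSplit_le_ennreal`; both sides may be `∞`, in which case it is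
vacuous — when the right side is finite it is the usual real inequality).  Proof: truncate the three weights to the boxes
`{|x_i| ≤ n}` (`trunc`, which preserves evenness and non-negativity), apply `chain3_weightSplit_le` at each `n`, convert the finite
nested real sums to `ℝ≥0∞` (`tsum3_ofReal_eq`), and pass to the limit `n → ∞` on the left by monotone convergence for nested series
(`tsum_iSup_of_monotone_nat`, `tsum3_ofReal_iSup`: the truncated integrands increase to the full one and are eventually equal to it
pointwise), bounding each level-`n` right side by the full right side.

HONEST FRAMING: elementary; no percolation object; nothing about any dimension.  What is NOT here: the boundary cases (ii)–(iv) of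
LEMMA-J Thm 3 and the identification of the engine's `N = 1` cell with this abstract diagram.
-/

noncomputable section

namespace Summit.CriticalPhenomena.LaceExpansionHighD.WeightSplit

open Finset
open scoped BigOperators ENNReal

variable {d : ℕ}

/-! ### B3.1 Monotone convergence for `ℕ`-indexed families of `ℝ≥0∞`-valued series -/

/-- `Σ' ⨆ₙ fₙ = ⨆ₙ Σ' fₙ` for a pointwise monotone sequence of `ℝ≥0∞`-valued functions. -/
theorem tsum_iSup_of_monotone_nat {α : Type*} {f : ℕ → α → ℝ≥0∞} (hf : ∀ a, Monotone fun n => f n a) :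
    ∑' a, ⨆ n, f n a = ⨆ n, ∑' a, f n a := by
  refine le_antisymm ?_ (iSup_le fun n => ENNReal.tsum_le_tsum fun a => le_iSup (fun n => f n a) n)
  rw [ENNReal.tsum_eq_iSup_sum]
  refine iSup_le fun s => ?_
  rw [ENNReal.finsetSum_iSup_of_monotone (fun a => hf a)]
  exact iSup_mono fun n => ENNReal.sum_le_tsum s

/-! ### B3.2 Truncation of a weight to a box -/

/-- The box `{x ∈ ℤ^d : |x_i| ≤ n for all i}` as a `Finset` (truncation region). -/
def box (d n : ℕ) : Finset (Fin d → ℤ) :=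
  Fintype.piFinset fun _ => Finset.Icc (-(n : ℤ)) n

/-- Membership in the box. -/
theorem mem_box {n : ℕ} {x : Fin d → ℤ} : x ∈ box d n ↔ ∀ i, |x i| ≤ n := by
  simp [box, Fintype.mem_piFinset, abs_le]

/-- The box is symmetric. -/
theorem neg_mem_box {n : ℕ} {x : Fin d → ℤ} : -x ∈ box d n ↔ x ∈ box d n := by
  simp [mem_box, abs_neg]

/-- The boxes increase. -/
theorem box_mono {n m : ℕ} (h : n ≤ m) : box d n ⊆ box d m := by
  intro x hx
  rw [mem_box] at hx ⊢
  exact fun i => (hx i).trans (by exact_mod_cast h)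

/-- Every point lies in all large boxes. -/
theorem exists_mem_box (x : Fin d → ℤ) : ∃ N : ℕ, ∀ n, N ≤ n → x ∈ box d n := by
  classical
  refine ⟨∑ i, (x i).natAbs, fun n hn => mem_box.2 fun i => ?_⟩
  have h0 : (x i).natAbs ≤ ∑ j, (x j).natAbs :=
    Finset.single_le_sum (f := fun j => (x j).natAbs) (fun j _ => Nat.zero_le _) (Finset.mem_univ i)
  have h1 : ((x i).natAbs : ℤ) ≤ ∑ j, ((x j).natAbs : ℤ) := by exact_mod_cast h0
  calc |x i| = ((x i).natAbs : ℤ) := (Int.natCast_natAbs (x i)).symm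
    _ ≤ ∑ j, ((x j).natAbs : ℤ) := h1
    _ ≤ n := by exact_mod_cast hn

/-- Truncation of a weight to the box of radius `n`. -/
def trunc (n : ℕ) (g : (Fin d → ℤ) → ℝ) (x : Fin d → ℤ) : ℝ :=
  if x ∈ box d n then g x else 0

/-- The truncation vanishes off the box. -/
theorem trunc_of_not_mem {n : ℕ} {g : (Fin d → ℤ) → ℝ} {x : Fin d → ℤ} (hx : x ∉ box d n) : trunc n g x = 0 := by
  simp [trunc, hx]

/-- Truncation preserves non-negativity. -/
theorem trunc_nonneg {n : ℕ} {g : (Fin d → ℤ) → ℝ} (hg : ∀ x, 0 ≤ g x) (x : Fin d → ℤ) : 0 ≤ trunc n g x := by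
  unfold trunc; split_ifs <;> simp [hg]

/-- Truncation preserves evenness (the box is symmetric). -/
theorem trunc_even {n : ℕ} {g : (Fin d → ℤ) → ℝ} (hg : Function.Even g) : Function.Even (trunc n g) := by
  intro x
  simp only [trunc, neg_mem_box, hg x]

/-- Truncation is below the weight. -/
theorem trunc_le_self {n : ℕ} {g : (Fin d → ℤ) → ℝ} (hg : ∀ x, 0 ≤ g x) (x : Fin d → ℤ) : trunc n g x ≤ g x := by
  unfold trunc; split_ifs <;> simp [hg]

/-- Truncations increase with the box. -/
theorem trunc_mono {n m : ℕ} (h : n ≤ m) {g : (Fin d → ℤ) → ℝ} (hg : ∀ x, 0 ≤ g x) (x : Fin d → ℤ) :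
    trunc n g x ≤ trunc m g x := by
  unfold trunc
  by_cases hx : x ∈ box d n
  · simp [hx, box_mono h hx]
  · simp [hx]; split_ifs <;> simp [hg]

/-- Inside the box the truncation is the weight. -/
theorem trunc_eq_self_of_mem {n : ℕ} {g : (Fin d → ℤ) → ℝ} {x : Fin d → ℤ} (hx : x ∈ box d n) : trunc n g x = g x := by
  simp [trunc, hx]

/-! ### B3.3 Nested sums of `ofReal`: monotone limits and conversion under finite support -/

/-- Nested monotone convergence: if `h n ↑` pointwise, is dominated by and eventually equal to `h∞`, then
`Σ'Σ'Σ' ofReal h∞ = ⨆ₙ Σ'Σ'Σ' ofReal (h n)`. -/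
theorem tsum3_ofReal_iSup {h : ℕ → (Fin d → ℤ) → (Fin d → ℤ) → (Fin d → ℤ) → ℝ}
    {hinf : (Fin d → ℤ) → (Fin d → ℤ) → (Fin d → ℤ) → ℝ}
    (hmono : ∀ w b c, Monotone fun n => h n w b c) (hle : ∀ n w b c, h n w b c ≤ hinf w b c)
    (hev : ∀ w b c, ∃ N, ∀ n, N ≤ n → h n w b c = hinf w b c) :
    ∑' w, ∑' b, ∑' c, ENNReal.ofReal (hinf w b c) = ⨆ n, ∑' w, ∑' b, ∑' c, ENNReal.ofReal (h n w b c) := by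
  -- pointwise
  have hpt : ∀ w b c, ENNReal.ofReal (hinf w b c) = ⨆ n, ENNReal.ofReal (h n w b c) := by
    intro w b c
    refine le_antisymm ?_ (iSup_le fun n => ENNReal.ofReal_le_ofReal (hle n w b c))
    obtain ⟨N, hN⟩ := hev w b c
    exact le_iSup_of_le N (by rw [hN N le_rfl])
  have m0 : ∀ w b c, Monotone fun n => ENNReal.ofReal (h n w b c) :=
    fun w b c n m hnm => ENNReal.ofReal_le_ofReal (hmono w b c hnm)
  have m1 : ∀ w b, Monotone fun n => ∑' c, ENNReal.ofReal (h n w b c) :=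
    fun w b n m hnm => ENNReal.tsum_le_tsum fun c => m0 w b c hnm
  have m2 : ∀ w, Monotone fun n => ∑' b, ∑' c, ENNReal.ofReal (h n w b c) :=
    fun w n m hnm => ENNReal.tsum_le_tsum fun b => m1 w b hnm
  simp_rw [hpt]
  simp_rw [tsum_iSup_of_monotone_nat (m0 _ _), tsum_iSup_of_monotone_nat (m1 _), tsum_iSup_of_monotone_nat m2]

/-- Nested conversion: for a non-negative integrand vanishing off a finite box in each variable,
`Σ'Σ'Σ' ofReal f = ofReal (Σ'Σ'Σ' f)`. -/
theorem tsum3_ofReal_eq {f : (Fin d → ℤ) → (Fin d → ℤ) → (Fin d → ℤ) → ℝ} (S : Finset (Fin d → ℤ))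
    (h0 : ∀ w b c, 0 ≤ f w b c) (hc : ∀ w b, ∀ c ∉ S, f w b c = 0) (hb : ∀ w, ∀ b ∉ S, ∀ c, f w b c = 0)
    (hw : ∀ w ∉ S, ∀ b c, f w b c = 0) :
    ∑' w, ∑' b, ∑' c, ENNReal.ofReal (f w b c) = ENNReal.ofReal (∑' w, ∑' b, ∑' c, f w b c) := by
  have lc : ∀ w b, ∑' c, ENNReal.ofReal (f w b c) = ENNReal.ofReal (∑' c, f w b c) := fun w b =>
    (ENNReal.ofReal_tsum_of_nonneg (h0 w b) (summable_of_ne_finset_zero (hc w b))).symm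
  have nb : ∀ w b, 0 ≤ ∑' c, f w b c := fun w b => tsum_nonneg (h0 w b)
  have sb : ∀ w, Summable fun b => ∑' c, f w b c := fun w =>
    summable_of_ne_finset_zero (s := S) fun b hb' => by simp [hb w b hb']
  have lb : ∀ w, ∑' b, ENNReal.ofReal (∑' c, f w b c) = ENNReal.ofReal (∑' b, ∑' c, f w b c) := fun w =>
    (ENNReal.ofReal_tsum_of_nonneg (nb w) (sb w)).symm
  have nw : ∀ w, 0 ≤ ∑' b, ∑' c, f w b c := fun w => tsum_nonneg (nb w)
  have sw : Summable fun w => ∑' b, ∑' c, f w b c :=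
    summable_of_ne_finset_zero (s := S) fun w hw' => by simp [hw w hw']
  simp_rw [lc, lb]
  exact (ENNReal.ofReal_tsum_of_nonneg nw sw).symm

/-! ### B3.4 The J-free inequality for arbitrary non-negative even block weights, in `ℝ≥0∞` -/

/-- Product of six non-negative factors is monotone in each factor (with a non-negative prefactor). -/
theorem prefactor_prod6_le {P a₁ a₂ a₃ a₄ a₅ a₆ b₁ b₂ b₃ b₄ b₅ b₆ : ℝ} (hP : 0 ≤ P)
    (h₁ : 0 ≤ a₁) (h₂ : 0 ≤ a₂) (h₃ : 0 ≤ a₃) (h₄ : 0 ≤ a₄) (h₅ : 0 ≤ a₅) (h₆ : 0 ≤ a₆)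
    (l₁ : a₁ ≤ b₁) (l₂ : a₂ ≤ b₂) (l₃ : a₃ ≤ b₃) (l₄ : a₄ ≤ b₄) (l₅ : a₅ ≤ b₅) (l₆ : a₆ ≤ b₆) :
    P * ((a₁ * a₂) * (a₃ * a₄) * (a₅ * a₆)) ≤ P * ((b₁ * b₂) * (b₃ * b₄) * (b₅ * b₆)) := by
  apply mul_le_mul_of_nonneg_left _ hP
  have hb₁ : 0 ≤ b₁ := h₁.trans l₁
  have hb₂ : 0 ≤ b₂ := h₂.trans l₂
  have hb₃ : 0 ≤ b₃ := h₃.trans l₃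
  have hb₄ : 0 ≤ b₄ := h₄.trans l₄
  have hb₅ : 0 ≤ b₅ := h₅.trans l₅
  gcongr

/-- **The `N = 1` generic bounding diagram is J-free — general form in `ℝ≥0∞`.**  As `chain3_weightSplit_le`, for
ARBITRARY non-negative even block weights `gL, g, gR` (no support or summability hypothesis; both sides may be `∞`):
`Σ_e κ_e Σ'_{w,b,c} ‖w+b+c‖² · gL(w+r₀)gL(w) · g(b+s−e)g(b) · gR(c−r₀−s)gR(c) ≤ Σ_e κ_e Σ'_{w,b,c} (‖w‖²+‖b‖²+‖c‖²) · (same)`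
as an inequality of `[0, ∞]`-valued sums.  Proof: truncate the weights to boxes (`trunc`), apply the finite-support theorem,
and pass to the monotone limit (`tsum3_ofReal_iSup`). -/
theorem chain3_weightSplit_le_ennreal (E : Finset (Fin d → ℤ)) (hE : ∀ e ∈ E, ∑ i, ((e i : ℤ) : ℝ) ^ 2 ≤ 1)
    (κ : (Fin d → ℤ) → ℝ) (hκ : ∀ e ∈ E, 0 ≤ κ e)
    (gL g gR : (Fin d → ℤ) → ℝ) (hL0 : ∀ x, 0 ≤ gL x) (hg0 : ∀ x, 0 ≤ g x) (hR0 : ∀ x, 0 ≤ gR x)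
    (hLe : Function.Even gL) (hge : Function.Even g) (hRe : Function.Even gR) (r₀ s : Fin d → ℤ) :
    ∑ e ∈ E, ENNReal.ofReal (κ e) * ∑' w, ∑' b, ∑' c, ENNReal.ofReal ((∑ i, ((w i : ℝ) + (b i : ℝ) + (c i : ℝ)) ^ 2)
        * ((gL (w + r₀) * gL w) * (g (b + (s - e)) * g b) * (gR (c + -(r₀ + s)) * gR c)))
      ≤ ∑ e ∈ E, ENNReal.ofReal (κ e) * ∑' w, ∑' b, ∑' c,
          ENNReal.ofReal ((∑ i, ((w i : ℝ)) ^ 2 + ∑ i, ((b i : ℝ)) ^ 2 + ∑ i, ((c i : ℝ)) ^ 2)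
            * ((gL (w + r₀) * gL w) * (g (b + (s - e)) * g b) * (gR (c + -(r₀ + s)) * gR c))) := by
  -- truncated weights
  have tL0 : ∀ n x, 0 ≤ trunc n gL x := fun n => trunc_nonneg hL0
  have tg0 : ∀ n x, 0 ≤ trunc n g x := fun n => trunc_nonneg hg0
  have tR0 : ∀ n x, 0 ≤ trunc n gR x := fun n => trunc_nonneg hR0
  -- the weight products, truncated and full
  set W : (Fin d → ℤ) → (Fin d → ℤ) → (Fin d → ℤ) → (Fin d → ℤ) → ℝ := fun e w b c =>
    (gL (w + r₀) * gL w) * (g (b + (s - e)) * g b) * (gR (c + -(r₀ + s)) * gR c) with hW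
  set Wn : ℕ → (Fin d → ℤ) → (Fin d → ℤ) → (Fin d → ℤ) → (Fin d → ℤ) → ℝ := fun n e w b c =>
    (trunc n gL (w + r₀) * trunc n gL w) * (trunc n g (b + (s - e)) * trunc n g b)
      * (trunc n gR (c + -(r₀ + s)) * trunc n gR c) with hWn
  show ∑ e ∈ E, ENNReal.ofReal (κ e) * ∑' w, ∑' b, ∑' c,
      ENNReal.ofReal ((∑ i, ((w i : ℝ) + (b i : ℝ) + (c i : ℝ)) ^ 2) * W e w b c)
    ≤ ∑ e ∈ E, ENNReal.ofReal (κ e) * ∑' w, ∑' b, ∑' c,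
      ENNReal.ofReal ((∑ i, ((w i : ℝ)) ^ 2 + ∑ i, ((b i : ℝ)) ^ 2 + ∑ i, ((c i : ℝ)) ^ 2) * W e w b c)
  have W0 : ∀ e w b c, 0 ≤ W e w b c := fun e w b c =>
    mul_nonneg (mul_nonneg (mul_nonneg (hL0 _) (hL0 _)) (mul_nonneg (hg0 _) (hg0 _))) (mul_nonneg (hR0 _) (hR0 _))
  have Wn0 : ∀ n e w b c, 0 ≤ Wn n e w b c := fun n e w b c =>
    mul_nonneg (mul_nonneg (mul_nonneg (tL0 _ _) (tL0 _ _)) (mul_nonneg (tg0 _ _) (tg0 _ _))) (mul_nonneg (tR0 _ _) (tR0 _ _))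
  -- monotonicity / domination / eventual equality of the truncated weights, with any non-negative prefactor
  have Wmono : ∀ {P : ℝ}, 0 ≤ P → ∀ e w b c, Monotone fun n => P * Wn n e w b c := by
    intro P hP e w b c n m hnm
    exact prefactor_prod6_le hP (tL0 _ _) (tL0 _ _) (tg0 _ _) (tg0 _ _) (tR0 _ _) (tR0 _ _)
      (trunc_mono hnm hL0 _) (trunc_mono hnm hL0 _) (trunc_mono hnm hg0 _) (trunc_mono hnm hg0 _)
      (trunc_mono hnm hR0 _) (trunc_mono hnm hR0 _)
  have Wle : ∀ {P : ℝ}, 0 ≤ P → ∀ n e w b c, P * Wn n e w b c ≤ P * W e w b c := by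
    intro P hP n e w b c
    exact prefactor_prod6_le hP (tL0 _ _) (tL0 _ _) (tg0 _ _) (tg0 _ _) (tR0 _ _) (tR0 _ _)
      (trunc_le_self hL0 _) (trunc_le_self hL0 _) (trunc_le_self hg0 _) (trunc_le_self hg0 _)
      (trunc_le_self hR0 _) (trunc_le_self hR0 _)
  have Wev : ∀ (P : ℝ) e w b c, ∃ N, ∀ n, N ≤ n → P * Wn n e w b c = P * W e w b c := by
    intro P e w b c
    obtain ⟨N₁, h₁⟩ := exists_mem_box (d := d) (w + r₀)
    obtain ⟨N₂, h₂⟩ := exists_mem_box (d := d) w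
    obtain ⟨N₃, h₃⟩ := exists_mem_box (d := d) (b + (s - e))
    obtain ⟨N₄, h₄⟩ := exists_mem_box (d := d) b
    obtain ⟨N₅, h₅⟩ := exists_mem_box (d := d) (c + -(r₀ + s))
    obtain ⟨N₆, h₆⟩ := exists_mem_box (d := d) c
    refine ⟨N₁ + N₂ + N₃ + N₄ + N₅ + N₆, fun n hn => ?_⟩
    simp only [hWn, hW, trunc_eq_self_of_mem (h₁ n (by omega)), trunc_eq_self_of_mem (h₂ n (by omega)),
      trunc_eq_self_of_mem (h₃ n (by omega)), trunc_eq_self_of_mem (h₄ n (by omega)),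
      trunc_eq_self_of_mem (h₅ n (by omega)), trunc_eq_self_of_mem (h₆ n (by omega))]
  -- the two prefactors
  have Psq0 : ∀ w b c : Fin d → ℤ, 0 ≤ ∑ i, ((w i : ℝ) + (b i : ℝ) + (c i : ℝ)) ^ 2 :=
    fun w b c => Finset.sum_nonneg fun i _ => sq_nonneg _
  have Pdg0 : ∀ w b c : Fin d → ℤ, 0 ≤ ∑ i, ((w i : ℝ)) ^ 2 + ∑ i, ((b i : ℝ)) ^ 2 + ∑ i, ((c i : ℝ)) ^ 2 :=
    fun w b c => add_nonneg (add_nonneg (Finset.sum_nonneg fun i _ => sq_nonneg _)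
      (Finset.sum_nonneg fun i _ => sq_nonneg _)) (Finset.sum_nonneg fun i _ => sq_nonneg _)
  -- Step 1: the left side as a monotone limit
  have hL : ∀ e, ∑' w, ∑' b, ∑' c, ENNReal.ofReal ((∑ i, ((w i : ℝ) + (b i : ℝ) + (c i : ℝ)) ^ 2) * W e w b c)
      = ⨆ n, ∑' w, ∑' b, ∑' c, ENNReal.ofReal ((∑ i, ((w i : ℝ) + (b i : ℝ) + (c i : ℝ)) ^ 2) * Wn n e w b c) :=
    fun e => tsum3_ofReal_iSup (fun w b c => Wmono (Psq0 w b c) e w b c) (fun n w b c => Wle (Psq0 w b c) n e w b c)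
      (fun w b c => Wev _ e w b c)
  have hmonoT : ∀ e, Monotone fun n => ENNReal.ofReal (κ e) *
      ∑' w, ∑' b, ∑' c, ENNReal.ofReal ((∑ i, ((w i : ℝ) + (b i : ℝ) + (c i : ℝ)) ^ 2) * Wn n e w b c) := by
    intro e n m hnm
    exact mul_le_mul' le_rfl (ENNReal.tsum_le_tsum fun w => ENNReal.tsum_le_tsum fun b =>
      ENNReal.tsum_le_tsum fun c => ENNReal.ofReal_le_ofReal (Wmono (Psq0 w b c) e w b c hnm))
  -- vanishing of truncated integrands off the box (for the conversion lemma)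
  have vc : ∀ (P : (Fin d → ℤ) → (Fin d → ℤ) → (Fin d → ℤ) → ℝ) n e w b, ∀ c ∉ box d n, P w b c * Wn n e w b c = 0 := by
    intro P n e w b c hc; simp [hWn, trunc_of_not_mem hc]
  have vb : ∀ (P : (Fin d → ℤ) → (Fin d → ℤ) → (Fin d → ℤ) → ℝ) n e w, ∀ b ∉ box d n, ∀ c, P w b c * Wn n e w b c = 0 := by
    intro P n e w b hb c; simp [hWn, trunc_of_not_mem hb]
  have vw : ∀ (P : (Fin d → ℤ) → (Fin d → ℤ) → (Fin d → ℤ) → ℝ) n e, ∀ w ∉ box d n, ∀ b c, P w b c * Wn n e w b c = 0 := by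
    intro P n e w hw b c; simp [hWn, trunc_of_not_mem hw]
  -- Step 2: rewrite and bound level by level
  simp_rw [hL]
  simp_rw [ENNReal.mul_iSup]
  rw [ENNReal.finsetSum_iSup_of_monotone hmonoT]
  refine iSup_le fun n => ?_
  -- level n: convert to reals, apply the finite-support theorem, convert back, compare with the full weights
  have hsupp : ∀ x ∉ box d n, trunc n gL x = 0 := fun x hx => trunc_of_not_mem hx
  have hsuppg : ∀ x ∉ box d n, trunc n g x = 0 := fun x hx => trunc_of_not_mem hx
  have hsuppR : ∀ x ∉ box d n, trunc n gR x = 0 := fun x hx => trunc_of_not_mem hx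
  have hreal := chain3_weightSplit_le E hE κ hκ (trunc n gL) (trunc n g) (trunc n gR) (tL0 n) (tg0 n) (tR0 n)
    (trunc_even hLe) (trunc_even hge) (trunc_even hRe) (box d n) (box d n) (box d n) hsupp hsuppg hsuppR r₀ s
  -- conversions
  have csq : ∀ e, ∑' w, ∑' b, ∑' c, ENNReal.ofReal ((∑ i, ((w i : ℝ) + (b i : ℝ) + (c i : ℝ)) ^ 2) * Wn n e w b c)
      = ENNReal.ofReal (∑' w, ∑' b, ∑' c, (∑ i, ((w i : ℝ) + (b i : ℝ) + (c i : ℝ)) ^ 2) * Wn n e w b c) :=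
    fun e => tsum3_ofReal_eq (box d n) (fun w b c => mul_nonneg (Psq0 w b c) (Wn0 n e w b c))
      (vc _ n e) (vb _ n e) (vw _ n e)
  have cdg : ∀ e, ∑' w, ∑' b, ∑' c,
        ENNReal.ofReal ((∑ i, ((w i : ℝ)) ^ 2 + ∑ i, ((b i : ℝ)) ^ 2 + ∑ i, ((c i : ℝ)) ^ 2) * Wn n e w b c)
      = ENNReal.ofReal (∑' w, ∑' b, ∑' c,
          (∑ i, ((w i : ℝ)) ^ 2 + ∑ i, ((b i : ℝ)) ^ 2 + ∑ i, ((c i : ℝ)) ^ 2) * Wn n e w b c) :=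
    fun e => tsum3_ofReal_eq (box d n) (fun w b c => mul_nonneg (Pdg0 w b c) (Wn0 n e w b c))
      (vc _ n e) (vb _ n e) (vw _ n e)
  have nsq : ∀ e, 0 ≤ ∑' w, ∑' b, ∑' c, (∑ i, ((w i : ℝ) + (b i : ℝ) + (c i : ℝ)) ^ 2) * Wn n e w b c :=
    fun e => tsum_nonneg fun w => tsum_nonneg fun b => tsum_nonneg fun c => mul_nonneg (Psq0 w b c) (Wn0 n e w b c)
  have ndg : ∀ e, 0 ≤ ∑' w, ∑' b, ∑' c,
      (∑ i, ((w i : ℝ)) ^ 2 + ∑ i, ((b i : ℝ)) ^ 2 + ∑ i, ((c i : ℝ)) ^ 2) * Wn n e w b c :=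
    fun e => tsum_nonneg fun w => tsum_nonneg fun b => tsum_nonneg fun c => mul_nonneg (Pdg0 w b c) (Wn0 n e w b c)
  calc ∑ e ∈ E, ENNReal.ofReal (κ e) *
          ∑' w, ∑' b, ∑' c, ENNReal.ofReal ((∑ i, ((w i : ℝ) + (b i : ℝ) + (c i : ℝ)) ^ 2) * Wn n e w b c)
      = ENNReal.ofReal (∑ e ∈ E, κ e *
          ∑' w, ∑' b, ∑' c, (∑ i, ((w i : ℝ) + (b i : ℝ) + (c i : ℝ)) ^ 2) * Wn n e w b c) := by
        rw [ENNReal.ofReal_sum_of_nonneg fun e he => mul_nonneg (hκ e he) (nsq e)]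
        refine Finset.sum_congr rfl fun e he => ?_
        rw [ENNReal.ofReal_mul (hκ e he), csq e]
    _ ≤ ENNReal.ofReal (∑ e ∈ E, κ e * ∑' w, ∑' b, ∑' c,
          (∑ i, ((w i : ℝ)) ^ 2 + ∑ i, ((b i : ℝ)) ^ 2 + ∑ i, ((c i : ℝ)) ^ 2) * Wn n e w b c) :=
        ENNReal.ofReal_le_ofReal (by simpa [hWn] using hreal)
    _ = ∑ e ∈ E, ENNReal.ofReal (κ e) * ∑' w, ∑' b, ∑' c,
          ENNReal.ofReal ((∑ i, ((w i : ℝ)) ^ 2 + ∑ i, ((b i : ℝ)) ^ 2 + ∑ i, ((c i : ℝ)) ^ 2) * Wn n e w b c) := by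
        rw [ENNReal.ofReal_sum_of_nonneg fun e he => mul_nonneg (hκ e he) (ndg e)]
        refine Finset.sum_congr rfl fun e he => ?_
        rw [ENNReal.ofReal_mul (hκ e he), cdg e]
    _ ≤ ∑ e ∈ E, ENNReal.ofReal (κ e) * ∑' w, ∑' b, ∑' c,
          ENNReal.ofReal ((∑ i, ((w i : ℝ)) ^ 2 + ∑ i, ((b i : ℝ)) ^ 2 + ∑ i, ((c i : ℝ)) ^ 2) * W e w b c) := by
        refine Finset.sum_le_sum fun e he => mul_le_mul' le_rfl ?_
        exact ENNReal.tsum_le_tsum fun w => ENNReal.tsum_le_tsum fun b => ENNReal.tsum_le_tsum fun c =>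
          ENNReal.ofReal_le_ofReal (Wle (Pdg0 w b c) n e w b c)

end Summit.CriticalPhenomena.LaceExpansionHighD.WeightSplit

end
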